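import Summits.QuantumFields.YangMills.Theorems.DiagonalMirrorRPRWilsonDiagonalModel

/-!
# Crux `DiagonalMirrorRPR` (stmt-QuantumFields-10604), line `sign-twisted-diagonal-trace`, construction F1_diag
# (director-ym O4 WORD 3 (A)): the SYMMETRIC light-cone chart `(v, u) = (x₀ − x₁, x₀ + x₁)` of the scheme's own ODD
# torus — the chart in which the swap is fibrewise — and its two-step diagonal transfer kernel

Helper for the crux `DiagonalMirrorRPR` of `YangMills` (routes `IsotropyFromPowerCounting`, `MirrorModularBoosts`,
`PencilRigidity`; item stmt-QuantumFields-10604), attached `--supports … --as helper`; it closes nothing by itself.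
Continuation of `…Theorems.DiagonalMirrorRPRWilsonDiagonalModel{Defs,,HalfSteps}` (the `x₁`-chart: standard torus =
sheared box torus; layers `LayerCfg`; `stepKernel`).  In the `x₁`-chart the swap `x₀ ↔ x₁` is SHEARED,
`(v, x₁) ↦ (−v, x₁ + v)`; on the scheme's own torus of ODD side `S = 2L_k + 1` the coordinate `u = x₀ + x₁` is a genuine
slab coordinate (`2` is a unit of `ℤ/Sℤ`) and the swap becomes `(v, u) ↦ (−v, u)`.  This is the core docstring's
"`A_k = K_k W_k^{−(S_k+1)/2}`": passing from `x₁` to `u = v + 2x₁` twists the second layer of the step by half a unit of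
the slab translation.

* §8 `half = 2⁻¹`, `two_mul_half` (odd `S`); the chart `lcSite x = (x₀ − x₁, (x₀ + x₁, x₂, x₃))`, its inverse `lcInv`
  (`lcEquiv hS`), the unit steps in the chart (`lcInv_shift`: `e₀ ↦ (v+1, u+1)`, `e₁ ↦ (v−1, u+1)`); the layer reading
  `layerReadU` / assembling `layerAssembleU` of a STANDARD-torus configuration `GaugeConfig 4 S G` (no box-torus detour),
  `lcEdgeEquiv hS`, `layerEquivU hS : GaugeConfig 4 S G ≃ᵐ (ℤ_S → LayerCfg S S G)`.
* §9 the step table `stepPlaqU` (every link reached through an `e₀`- or `e₁`-step is shifted by `u ↦ u+1`), the step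
  action `stepActionU`, the kernel **`stepKernelU ρ β Z Z' = exp(β · stepActionU ρ Z Z') > 0`**; PROVED:
  `stepPlaqU_layerReadU_fst/snd` (the table IS Wilson's `plaquetteHolonomy` at `lcInv (v, s)` / `lcInv (v+1, s)`),
  **`wilsonAction_eq_sum_stepActionU`** (`S(U) = N_c #plaq − Σ_v stepActionU ρ Z_v Z_{v+1}`, odd `S`),
  `exp_neg_mul_wilsonAction_eq_prod_stepKernelU`, and the regularity of `K_u` (jointly continuous, norm-bounded, strongly
  measurable: the hypotheses of `Literature/Analysis/OperatorTheory/PositiveKernelTransferOperator` & co.).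

Companion `…WilsonDiagonalModelOddTorusChain`: Wilson's measure / `latticeSchwinger` as the cyclic `K_u`-chain,
`Tr K_u^m ≥ 0`, `Tr K_u^S > 0`, the fibrewise swap on layers, the two half steps and their Θ-pseudo-symmetry, the Schur-cut
form of the Θ-twisted even step.  OWED (unchanged): the operator/spectral layer (`A = Ê^{1/2} Ô Ê^{1/2}`, HS bound, trace
formulas) and the `famObs` pairing layer; no `def wilsonDiagonalModel : DiagonalSliceModel r sch` yet.
HONEST FRAMING: a construction helper; nothing about D_old ⟨10604⟩, the RP crux of the FOLD restate, or the summit is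
proved; the Yang–Mills mass gap is NOT proved here or anywhere in the tree.

References: K. Osterwalder, E. Seiler, Ann. Phys. 110 (1978) §2–3; E. Seiler, LNP 159 (1982) Ch. 2; J. Fröhlich, R. Israel,
E. Lieb, B. Simon, Comm. Math. Phys. 62 (1978) Thm 2.1.
-/

set_option autoImplicit false

noncomputable section

open MeasureTheory
open Literature.MathematicalPhysics.QuantumLattice Literature.MathematicalPhysics.QuantumFieldTheory
open Summit.QuantumFields.YangMills.Cruxes.DiagonalMirrorRPR.ParityBridgeColdTraces

namespace Summit.QuantumFields.YangMills.Cruxes.DiagonalMirrorRPR.SignTwistedDiagonalTrace.WilsonDiagonal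

/-! ## §8 The symmetric light-cone chart `(v, u) = (x₀ − x₁, x₀ + x₁)` of the ODD torus -/

section UChart

variable {S : ℕ}

/-- One half in `ℤ/Sℤ` (a genuine inverse of `2` iff `S` is odd). -/
def half : ZMod S := (2 : ZMod S)⁻¹

/-- For odd `S`, `2 · half = 1`. -/
theorem two_mul_half (hS : Odd S) : (2 : ZMod S) * half = 1 := by
  have h : Nat.Coprime 2 S := Nat.coprime_two_left.2 hS
  have := ZMod.coe_mul_inv_eq_one 2 h
  simpa [half] using this

/-- For odd `S`, `a + a` times `half` is `a`. -/
theorem add_self_mul_half (hS : Odd S) (a : ZMod S) : (a + a) * half = a := by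
  rw [← two_mul, mul_comm (2 : ZMod S) a, mul_assoc, two_mul_half hS, mul_one]

/-- For odd `S`, `half + half = 1`. -/
theorem half_add_half (hS : Odd S) : (half : ZMod S) + half = 1 := by
  rw [← two_mul, two_mul_half hS]

/-- The symmetric light-cone reading of a site: `x ↦ (v, (u, x₂, x₃))`, `v = x₀ − x₁` (slab index), `u = x₀ + x₁`
(slab coordinate FIXED by the swap `x₀ ↔ x₁`, which acts by `v ↦ −v` only). -/
def lcSite (x : Literature.MathematicalPhysics.QuantumFieldTheory.Site 4 S) : ZMod S × SlabSite S S :=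
  (x 0 - x 1, (x 0 + x 1, x 2, x 3))

/-- The inverse chart `(v, (u, y, z)) ↦ ((u + v)/2, (u − v)/2, y, z)` (a genuine inverse iff `S` is odd). -/
def lcInv (p : ZMod S × SlabSite S S) : Literature.MathematicalPhysics.QuantumFieldTheory.Site 4 S :=
  ![(p.2.1 + p.1) * half, (p.2.1 - p.1) * half, p.2.2.1, p.2.2.2]

/-- `lcInv ∘ lcSite = id` for odd `S`. -/
theorem lcInv_lcSite (hS : Odd S) (x : Literature.MathematicalPhysics.QuantumFieldTheory.Site 4 S) :
    lcInv (lcSite x) = x := by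
  funext i
  fin_cases i
  · simp only [lcInv, lcSite]
    rw [show x 0 + x 1 + (x 0 - x 1) = x 0 + x 0 by ring, add_self_mul_half hS]; rfl
  · simp only [lcInv, lcSite]
    rw [show x 0 + x 1 - (x 0 - x 1) = x 1 + x 1 by ring, add_self_mul_half hS]; rfl
  · rfl
  · rfl

/-- `lcSite ∘ lcInv = id` for odd `S`. -/
theorem lcSite_lcInv (hS : Odd S) (p : ZMod S × SlabSite S S) : lcSite (lcInv p) = p := by
  obtain ⟨v, u, y, z⟩ := p
  simp only [lcSite, lcInv, Matrix.cons_val_zero, Matrix.cons_val_one, Matrix.cons_val]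
  refine Prod.ext ?_ (Prod.ext ?_ rfl)
  · show (u + v) * half - (u - v) * half = v
    rw [← sub_mul, show u + v - (u - v) = v + v by ring, add_self_mul_half hS]
  · show (u + v) * half + (u - v) * half = u
    rw [← add_mul, show u + v + (u - v) = u + u by ring, add_self_mul_half hS]

/-- The symmetric light-cone chart as an equivalence (odd `S`). -/
def lcEquiv (hS : Odd S) : Literature.MathematicalPhysics.QuantumFieldTheory.Site 4 S ≃ ZMod S × SlabSite S S where
  toFun := lcSite
  invFun := lcInv
  left_inv := lcInv_lcSite hS
  right_inv := lcSite_lcInv hS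

/-- The slab-index increments of the four unit steps: `e₀ ↦ +1`, `e₁ ↦ −1`, `e₂, e₃ ↦ 0`. -/
def vStep (i : Fin 4) : ZMod S := ![1, -1, 0, 0] i

/-- The slab-coordinate increments of the four unit steps: `e₀, e₁ ↦ u + 1`, `e₂ ↦ y + 1`, `e₃ ↦ z + 1`. -/
def uStep (i : Fin 4) : SlabSite S S :=
  ![((1 : ZMod S), (0 : ZMod S), (0 : ZMod S)), ((1 : ZMod S), (0 : ZMod S), (0 : ZMod S)),
    ((0 : ZMod S), (1 : ZMod S), (0 : ZMod S)), ((0 : ZMod S), (0 : ZMod S), (1 : ZMod S))] i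

/-- **Unit steps in the chart**: `lcInv (v, s) + eᵢ = lcInv (v + vStep i, s + uStep i)` (odd `S`). -/
theorem lcInv_shift (hS : Odd S) (v : ZMod S) (s : SlabSite S S) (i : Fin 4) :
    (lcInv (v, s)).shift i = lcInv (v + vStep i, s + uStep i) := by
  obtain ⟨u, y, z⟩ := s
  have h2 := half_add_half (S := S) hS
  funext k
  fin_cases i <;> fin_cases k <;>
    simp [lcInv, vStep, uStep, Literature.MathematicalPhysics.QuantumFieldTheory.Site.shift] <;>
    first
      | ring1
      | linear_combination (-1 : ZMod S) * h2

variable {G : Type*}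

/-- Reading the layers of a standard-torus configuration in the symmetric chart: layer `v` holds the in-slab links
(directions `2, 3`) and the outgoing `e₁`-bonds of slab `v`, and the `e₀`-bonds arriving from slab `v − 1`, all labelled
by the slab coordinate `(u, y, z)` of their base point. -/
def layerReadU (U : GaugeConfig 4 S G) (t : ZMod S) : LayerCfg S S G :=
  fun p => U (lcInv (if p.2 = 0 then t - 1 else t, p.1), p.2)

/-- The relabelling `edge ↦ (layer, label)` of the standard torus in the symmetric chart. -/
def lcEdge (e : Literature.MathematicalPhysics.QuantumFieldTheory.Edge 4 S) : ZMod S × LayerIdx S S :=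
  (if e.2 = 0 then (lcSite e.1).1 + 1 else (lcSite e.1).1, ((lcSite e.1).2, e.2))

/-- Its inverse. -/
def lcEdgeInv (q : ZMod S × LayerIdx S S) : Literature.MathematicalPhysics.QuantumFieldTheory.Edge 4 S :=
  (lcInv (if q.2.2 = 0 then q.1 - 1 else q.1, q.2.1), q.2.2)

/-- The edge relabelling is an equivalence (odd `S`). -/
def lcEdgeEquiv (hS : Odd S) : Literature.MathematicalPhysics.QuantumFieldTheory.Edge 4 S ≃ ZMod S × LayerIdx S S where
  toFun := lcEdge
  invFun := lcEdgeInv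
  left_inv e := by
    obtain ⟨x, i⟩ := e
    by_cases h : i = 0
    · simp only [lcEdge, lcEdgeInv, h, ↓reduceIte, add_sub_cancel_right]
      rw [show ((lcSite x).1, (lcSite x).2) = lcSite x from rfl, lcInv_lcSite hS]
    · simp only [lcEdge, lcEdgeInv, h, ↓reduceIte]
      rw [show ((lcSite x).1, (lcSite x).2) = lcSite x from rfl, lcInv_lcSite hS]
  right_inv q := by
    obtain ⟨t, s, i⟩ := q
    by_cases h : i = 0
    · simp [lcEdge, lcEdgeInv, h, lcSite_lcInv hS]
    · simp [lcEdge, lcEdgeInv, h, lcSite_lcInv hS]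

/-- Assembling a standard-torus configuration from symmetric-chart layers. -/
def layerAssembleU (Z : ZMod S → LayerCfg S S G) : GaugeConfig 4 S G := fun e => Z (lcEdge e).1 (lcEdge e).2

/-- `layerReadU` is evaluation at `lcEdgeInv`. -/
theorem layerReadU_eq (U : GaugeConfig 4 S G) (t : ZMod S) (p : LayerIdx S S) :
    layerReadU U t p = U (lcEdgeInv (t, p)) := rfl

/-- `layerAssembleU ∘ layerReadU = id` (odd `S`). -/
theorem layerAssembleU_layerReadU (hS : Odd S) (U : GaugeConfig 4 S G) : layerAssembleU (layerReadU U) = U := by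
  funext e
  simp only [layerAssembleU, layerReadU_eq]
  exact congrArg U ((lcEdgeEquiv hS).left_inv e)

/-- `layerReadU ∘ layerAssembleU = id` (odd `S`). -/
theorem layerReadU_layerAssembleU (hS : Odd S) (Z : ZMod S → LayerCfg S S G) : layerReadU (layerAssembleU Z) = Z := by
  funext t p
  simp only [layerReadU_eq, layerAssembleU]
  have h : lcEdge (lcEdgeInv (t, p)) = (t, p) := (lcEdgeEquiv (S := S) hS).right_inv (t, p)
  rw [h]

variable [MeasurableSpace G]

/-- **The symmetric-chart layer equivalence** `GaugeConfig 4 S G ≃ᵐ (ℤ_S → LayerCfg S S G)` (odd `S`). -/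
def layerEquivU (hS : Odd S) : GaugeConfig 4 S G ≃ᵐ (ZMod S → LayerCfg S S G) :=
  (MeasurableEquiv.piCongrLeft (fun _ : ZMod S × LayerIdx S S => G) (lcEdgeEquiv hS)).trans
    (MeasurableEquiv.curry (ZMod S) (LayerIdx S S) G)

/-- The layer equivalence reads layers. -/
theorem layerEquivU_apply (hS : Odd S) (U : GaugeConfig 4 S G) : layerEquivU hS U = layerReadU U := by
  funext t p
  simp only [layerEquivU, MeasurableEquiv.trans_apply, MeasurableEquiv.coe_curry, Function.curry_apply,
    MeasurableEquiv.coe_piCongrLeft, Equiv.piCongrLeft_apply_eq_cast, cast_eq, layerReadU_eq]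
  rfl

end UChart

/-! ## §9 The step table in the symmetric chart -/

section UKernel

variable {S : ℕ} [NeZero S] {G : Type*} [Group G]

/-- **The six plaquette holonomies of one diagonal step in the symmetric chart** (`σ₁ = (1,0,0)` is the unit
`u`-shift): compared with the `x₁`-chart table `stepPlaq`, every link reached through an `e₀`-step is shifted by
`u ↦ u + 1` as well. -/
def stepPlaqU (Z Z' : LayerCfg S S G) (s : SlabSite S S) : Fin 4 → Fin 4 → G :=
  ![![1, Z' (s, 0) * Z' (s + slabStep 1, 1) * (Z (s + slabStep 1, 0))⁻¹ * (Z (s, 1))⁻¹,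
      Z' (s, 0) * Z' (s + slabStep 1, 2) * (Z' (s + slabStep 2, 0))⁻¹ * (Z (s, 2))⁻¹,
      Z' (s, 0) * Z' (s + slabStep 1, 3) * (Z' (s + slabStep 3, 0))⁻¹ * (Z (s, 3))⁻¹],
    ![1, 1, Z' (s, 1) * Z (s + slabStep 1, 2) * (Z' (s + slabStep 2, 1))⁻¹ * (Z' (s, 2))⁻¹,
      Z' (s, 1) * Z (s + slabStep 1, 3) * (Z' (s + slabStep 3, 1))⁻¹ * (Z' (s, 3))⁻¹],
    ![1, 1, 1, Z (s, 2) * Z (s + slabStep 2, 3) * (Z (s + slabStep 3, 2))⁻¹ * (Z (s, 3))⁻¹],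
    ![1, 1, 1, 1]]

variable {Nc : ℕ} (ρ : G →* Matrix (Fin Nc) (Fin Nc) ℂ)

/-- The step action in the symmetric chart. -/
def stepActionU (Z Z' : LayerCfg S S G) : ℝ :=
  ∑ s : SlabSite S S, ∑ i : Fin 4, ∑ j : Fin 4, if i < j then (ρ (stepPlaqU Z Z' s i j)).trace.re else 0

/-- **The two-step diagonal transfer kernel in the symmetric chart** — the core docstring's `A`-kernel
`K W^{-(S+1)/2}` (the `x₁`-chart kernel `stepKernel` twisted by half a unit of the slab translation): positive, bounded,
continuous; NOT symmetric (two different half steps), but its half steps are Θ-pseudo-symmetric for the FIBREWISE label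
involution (§11). -/
def stepKernelU (β : ℝ) (Z Z' : LayerCfg S S G) : ℝ :=
  Real.exp (β * stepActionU ρ Z Z')

/-- The symmetric-chart kernel is strictly positive. -/
theorem stepKernelU_pos (β : ℝ) (Z Z' : LayerCfg S S G) : 0 < stepKernelU ρ β Z Z' := Real.exp_pos _

omit [NeZero S] in
/-- The step table reads Wilson's plaquettes (planes `(0,1),(0,2),(0,3),(2,3)` based in slab `v`). -/
theorem stepPlaqU_layerReadU_fst (hS : Odd S) (U : GaugeConfig 4 S G) (t : ZMod S) (s : SlabSite S S) :
    stepPlaqU (layerReadU U t) (layerReadU U (t + 1)) s 0 1 = plaquetteHolonomy U (lcInv (t, s)) 0 1 ∧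
    stepPlaqU (layerReadU U t) (layerReadU U (t + 1)) s 0 2 = plaquetteHolonomy U (lcInv (t, s)) 0 2 ∧
    stepPlaqU (layerReadU U t) (layerReadU U (t + 1)) s 0 3 = plaquetteHolonomy U (lcInv (t, s)) 0 3 ∧
    stepPlaqU (layerReadU U t) (layerReadU U (t + 1)) s 2 3 = plaquetteHolonomy U (lcInv (t, s)) 2 3 := by
  simp only [stepPlaqU, plaquetteHolonomy, lcInv_shift hS, layerReadU]
  simp [vStep, uStep, slabStep, sub_eq_add_neg]

omit [NeZero S] in
/-- The step table reads Wilson's plaquettes (planes `(1,2),(1,3)` based in slab `v+1`). -/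
theorem stepPlaqU_layerReadU_snd (hS : Odd S) (U : GaugeConfig 4 S G) (t : ZMod S) (s : SlabSite S S) :
    stepPlaqU (layerReadU U t) (layerReadU U (t + 1)) s 1 2 = plaquetteHolonomy U (lcInv (t + 1, s)) 1 2 ∧
    stepPlaqU (layerReadU U t) (layerReadU U (t + 1)) s 1 3 = plaquetteHolonomy U (lcInv (t + 1, s)) 1 3 := by
  simp only [stepPlaqU, plaquetteHolonomy, lcInv_shift hS, layerReadU]
  simp [vStep, uStep, slabStep, sub_eq_add_neg]

/-- **The diagonal decomposition of Wilson's action on the standard odd torus (symmetric chart)**: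
`S(U) = N_c · #plaquettes − Σ_{v : ℤ_S} stepActionU ρ (Z_v U) (Z_{v+1} U)`. -/
theorem wilsonAction_eq_sum_stepActionU (hS : Odd S) (U : GaugeConfig 4 S G) :
    wilsonAction ρ U = (Nc : ℝ) * Fintype.card (Plaquette 4 S) -
      ∑ t : ZMod S, stepActionU ρ (layerReadU U t) (layerReadU U (t + 1)) := by
  unfold wilsonAction
  rw [Finset.sum_sub_distrib, Finset.sum_const, Finset.card_univ, nsmul_eq_mul, mul_comm]
  congr 1
  rw [sum_plaquette_eq' (fun x i j => (ρ (plaquetteHolonomy U x i j)).trace.re), ← (lcEquiv hS).symm.sum_comp,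
    Fintype.sum_prod_type]
  simp only [lcEquiv, Equiv.coe_fn_symm_mk]
  -- the six plaquette terms based at a chart point
  set p : ZMod S → SlabSite S S → Fin 4 → Fin 4 → ℝ := fun τ s i j =>
    (ρ (plaquetteHolonomy U (lcInv (τ, s)) i j)).trace.re with hp
  set A : ZMod S → ℝ := fun τ => ∑ s : SlabSite S S, (p τ s 0 1 + p τ s 0 2 + p τ s 0 3 + p τ s 2 3) with hA
  set B : ZMod S → ℝ := fun τ => ∑ s : SlabSite S S, (p τ s 1 2 + p τ s 1 3) with hB
  have hL : ∑ τ : ZMod S, ∑ s : SlabSite S S, ∑ i : Fin 4, ∑ j : Fin 4,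
      (if i < j then (ρ (plaquetteHolonomy U (lcInv (τ, s)) i j)).trace.re else 0) = ∑ τ : ZMod S, (A τ + B τ) := by
    refine Finset.sum_congr rfl fun τ _ => ?_
    rw [hA, hB, ← Finset.sum_add_distrib]
    refine Finset.sum_congr rfl fun s _ => ?_
    rw [sum_fin4_lt]
    simp only [hp]
    ring
  have hR : ∀ t : ZMod S, stepActionU ρ (layerReadU U t) (layerReadU U (t + 1)) = A t + B (t + 1) := by
    intro t
    unfold stepActionU
    rw [hA, hB, ← Finset.sum_add_distrib]
    refine Finset.sum_congr rfl fun s _ => ?_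
    obtain ⟨h01, h02, h03, h23⟩ := stepPlaqU_layerReadU_fst hS U t s
    obtain ⟨h12, h13⟩ := stepPlaqU_layerReadU_snd hS U t s
    rw [sum_fin4_lt, h01, h02, h03, h23, h12, h13]
    simp only [hp]
    ring
  rw [hL]
  simp only [hR]
  rw [Finset.sum_add_distrib, Finset.sum_add_distrib]
  congr 1
  exact (Fintype.sum_equiv (Equiv.addRight (1 : ZMod S)) (fun t => B (t + 1)) B fun _ => rfl).symm

/-- **Boltzmann factor of the standard odd torus through the symmetric-chart kernel**:
`exp(−β S(U)) = exp(−β N_c #plaquettes) · ∏_v K_u(Z_v, Z_{v+1})`. -/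
theorem exp_neg_mul_wilsonAction_eq_prod_stepKernelU (hS : Odd S) (β : ℝ) (U : GaugeConfig 4 S G) :
    Real.exp (-β * wilsonAction ρ U) = Real.exp (-β * ((Nc : ℝ) * Fintype.card (Plaquette 4 S))) *
      ∏ t : ZMod S, stepKernelU ρ β (layerReadU U t) (layerReadU U (t + 1)) := by
  unfold stepKernelU
  rw [wilsonAction_eq_sum_stepActionU ρ hS, ← Real.exp_sum, ← Real.exp_add, ← Finset.mul_sum]
  congr 1
  ring

/-! ### Regularity of the symmetric-chart kernel -/

omit [NeZero S] in
/-- Every entry of the symmetric-chart step table is a continuous function of the pair of layers. -/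
theorem continuous_stepPlaqU [TopologicalSpace G] [IsTopologicalGroup G] (s : SlabSite S S) (i j : Fin 4) :
    Continuous fun ZZ' : LayerCfg S S G × LayerCfg S S G => stepPlaqU ZZ'.1 ZZ'.2 s i j := by
  fin_cases i <;> fin_cases j <;> simp [stepPlaqU] <;> fun_prop

/-- The symmetric-chart step action is jointly continuous (continuous `ρ`). -/
theorem continuous_stepActionU [TopologicalSpace G] [IsTopologicalGroup G] (hρ : Continuous ρ) :
    Continuous fun ZZ' : LayerCfg S S G × LayerCfg S S G => stepActionU ρ ZZ'.1 ZZ'.2 := by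
  unfold stepActionU
  refine continuous_finsetSum _ fun s _ => continuous_finsetSum _ fun i _ =>
    continuous_finsetSum _ fun j _ => ?_
  split_ifs
  · exact Complex.continuous_re.comp (Continuous.matrix_trace (hρ.comp (continuous_stepPlaqU s i j)))
  · exact continuous_const

/-- The symmetric-chart kernel is jointly continuous. -/
theorem continuous_stepKernelU [TopologicalSpace G] [IsTopologicalGroup G] (hρ : Continuous ρ) (β : ℝ) :
    Continuous (Function.uncurry (stepKernelU (S := S) ρ β) : LayerCfg S S G × LayerCfg S S G → ℝ) :=
  Real.continuous_exp.comp (continuous_const.mul (continuous_stepActionU ρ hρ))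

/-- The symmetric-chart kernel is bounded in norm. -/
theorem exists_norm_stepKernelU_le [TopologicalSpace G] [IsTopologicalGroup G] [CompactSpace G]
    (hρ : Continuous ρ) (β : ℝ) : ∃ C : ℝ, ∀ Z Z' : LayerCfg S S G, ‖stepKernelU ρ β Z Z'‖ ≤ C := by
  obtain ⟨C, hC⟩ := (isCompact_univ.image (continuous_stepKernelU (S := S) ρ hρ β)).isBounded.bddAbove
  refine ⟨C, fun Z Z' => ?_⟩
  rw [Real.norm_of_nonneg (stepKernelU_pos ρ β Z Z').le]
  exact hC ⟨(Z, Z'), Set.mem_univ _, rfl⟩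

/-- The symmetric-chart kernel is strongly measurable as a function of the pair. -/
theorem stronglyMeasurable_stepKernelU [TopologicalSpace G] [IsTopologicalGroup G] [MeasurableSpace G]
    [BorelSpace G] [SecondCountableTopology G] (hρ : Continuous ρ) (β : ℝ) :
    StronglyMeasurable (Function.uncurry (stepKernelU (S := S) ρ β) : LayerCfg S S G × LayerCfg S S G → ℝ) :=
  (continuous_stepKernelU ρ hρ β).measurable.stronglyMeasurable

end UKernel

end Summit.QuantumFields.YangMills.Cruxes.DiagonalMirrorRPR.SignTwistedDiagonalTrace.WilsonDiagonal

end
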